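import Mathlib.Analysis.SpecialFunctions.Exponential
import Mathlib.Analysis.Calculus.SmoothSeries
import Mathlib.Analysis.Calculus.Deriv.Pow
import Mathlib.Analysis.Calculus.Deriv.Mul
import Mathlib.Analysis.Calculus.Deriv.Add
import Mathlib.Analysis.Calculus.Deriv.Comp
import Mathlib.Analysis.Calculus.MeanValue
import Mathlib.Analysis.Normed.Ring.Units
import Mathlib.Analysis.Analytic.OfScalars
import Mathlib.Topology.Algebra.Algebra
import HarnessLib

/-!
# The logarithmic series near `1` in a Banach algebra

For an element `x` of a complete normed `ℂ`-algebra `𝔄` with `‖x‖ < 1` the logarithmic series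

  `log (1 + x) := ∑_{n ≥ 1} (-1)^{n+1} xⁿ / n`

converges absolutely (`logOnePlus`, `hasSum_logOnePlus`), `‖log (1 + x)‖ ≤ ‖x‖ / (1 - ‖x‖)`
(`norm_logOnePlus_le`), the map `x ↦ log (1 + x)` is analytic on the open unit ball of `𝔄`
(`analyticAt_logOnePlus`, `differentiableOn_logOnePlus`), and

  `exp (log (1 + x)) = 1 + x`            (`exp_logOnePlus`).

This is the standard local right inverse of the exponential map of the Banach Lie group `𝔄ˣ`
near `1` (e.g. H. Cartan, *Sur les matrices holomorphes de `n` variables complexes*, J. Math.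
Pures Appl. 19 (1940), §2, for matrices; Bourbaki, *Lie Groups*, Ch. III §6; Rudin,
*Functional Analysis*, Thm. 10.30 for the functional-calculus version). It is the device by which a
holomorphic invertible matrix close to the identity is written as an exponential, used in Grauert's
Runge theorem for `GL_r`-valued maps and in the Oka–Grauert principle.

## The argument

Convergence and the norm bound are comparison with the geometric series. Analyticity: the series is
the power series `FormalMultilinearSeries.ofScalars 𝔄 logSeriesCoeff`, whose radius is `≥ 1`. For the
identity `exp ∘ log = id` we first treat a *commutative* complete normed algebra `𝔠`: for `‖y‖ < 1`
and `t` in a disc `|t| < ρ`, `ρ‖y‖ < 1 < ρ`, term-wise differentiation gives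
`d/dt log (1 + t y) = y (1 + t y)⁻¹` (geometric series), so by the chain rule for `exp` (which has
derivative `exp a • 1` in the commutative case) the function `k(t) = exp (-log (1 + t y)) (1 + t y)`
has derivative `0` on the disc, hence `k(1) = k(0) = 1`, i.e. `exp (log (1 + y)) = 1 + y`. The general
case follows by applying this in the closed commutative subalgebra `Algebra.elemental ℂ x` generated
by `x` and pushing forward along its (continuous) inclusion, which commutes with `exp` and with the
series.

## References

* H. Cartan, *Sur les matrices holomorphes de `n` variables complexes*, J. Math. Pures Appl. 19
  (1940) 1–26, §2.
* W. Rudin, *Functional Analysis*, 2nd ed. (1991), Thm. 10.30. [folklore]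
-/

noncomputable section

open scoped Topology
open Filter Metric Set NormedSpace FormalMultilinearSeries

namespace Literature.Analysis.Complex

/-- The coefficients of the logarithmic series: `logSeriesCoeff n = (-1)^{n+1} / n` (so `logSeriesCoeff 0 = 0`).
[folklore] -/
def logSeriesCoeff (n : ℕ) : ℂ := (-1) ^ (n + 1) / n

/-- `logSeriesCoeff 0 = 0`. [folklore] -/
@[simp] theorem logSeriesCoeff_zero : logSeriesCoeff 0 = 0 := by simp [logSeriesCoeff]

/-- `|logSeriesCoeff n| ≤ 1`. [folklore] -/
theorem norm_logSeriesCoeff_le (n : ℕ) : ‖logSeriesCoeff n‖ ≤ 1 := by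
  rcases Nat.eq_zero_or_pos n with rfl | hn
  · simp
  · rw [logSeriesCoeff, norm_div, norm_pow, norm_neg, norm_one, one_pow, Complex.norm_natCast, one_div]
    exact inv_le_one_of_one_le₀ (by exact_mod_cast hn)

/-- `logSeriesCoeff (n + 1) * (n + 1) = (-1)^n`. [folklore] -/
theorem logSeriesCoeff_succ_mul (n : ℕ) : logSeriesCoeff (n + 1) * (n + 1) = (-1) ^ n := by
  rw [logSeriesCoeff, pow_succ, pow_succ, Nat.cast_succ]
  field_simp

section General

variable {𝔄 : Type*} [NormedRing 𝔄] [NormedAlgebra ℂ 𝔄] [CompleteSpace 𝔄]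

/-- The logarithmic series `log (1 + x) = ∑_{n ≥ 1} (-1)^{n+1} xⁿ / n` in a Banach algebra
(meaningful for `‖x‖ < 1`). [folklore] -/
def logOnePlus (x : 𝔄) : 𝔄 := ∑' n : ℕ, logSeriesCoeff n • x ^ n

omit [CompleteSpace 𝔄] in
/-- The terms of the logarithmic series are dominated by the geometric series. [folklore] -/
theorem norm_logSeriesCoeff_smul_pow_le (x : 𝔄) (n : ℕ) : ‖logSeriesCoeff n • x ^ n‖ ≤ ‖x‖ ^ n := by
  rcases Nat.eq_zero_or_pos n with rfl | hn
  · simp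
  · refine (norm_smul_le _ _).trans ?_
    calc ‖logSeriesCoeff n‖ * ‖x ^ n‖ ≤ 1 * ‖x‖ ^ n :=
          mul_le_mul (norm_logSeriesCoeff_le n) (norm_pow_le' x hn) (norm_nonneg _) zero_le_one
      _ = ‖x‖ ^ n := one_mul _

/-- The logarithmic series converges (absolutely) for `‖x‖ < 1`. [folklore] -/
theorem summable_logOnePlus {x : 𝔄} (hx : ‖x‖ < 1) :
    Summable fun n : ℕ => logSeriesCoeff n • x ^ n :=
  .of_norm_bounded (summable_geometric_of_lt_one (norm_nonneg x) hx)
    (norm_logSeriesCoeff_smul_pow_le x)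

/-- The logarithmic series sums to `logOnePlus x` for `‖x‖ < 1`. [folklore] -/
theorem hasSum_logOnePlus {x : 𝔄} (hx : ‖x‖ < 1) :
    HasSum (fun n : ℕ => logSeriesCoeff n • x ^ n) (logOnePlus x) :=
  (summable_logOnePlus hx).hasSum

omit [CompleteSpace 𝔄] in
/-- `log (1 + 0) = 0`. [folklore] -/
@[simp] theorem logOnePlus_zero : logOnePlus (0 : 𝔄) = 0 := by
  rw [logOnePlus]
  refine (tsum_congr fun n => ?_).trans tsum_zero
  rcases Nat.eq_zero_or_pos n with rfl | hn
  · simp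
  · simp [zero_pow hn.ne']

/-- `‖log (1 + x)‖ ≤ ‖x‖ / (1 - ‖x‖)` for `‖x‖ < 1`. [folklore] -/
theorem norm_logOnePlus_le {x : 𝔄} (hx : ‖x‖ < 1) : ‖logOnePlus x‖ ≤ ‖x‖ / (1 - ‖x‖) := by
  rw [logOnePlus, (summable_logOnePlus hx).tsum_eq_zero_add]
  simp only [pow_zero, logSeriesCoeff_zero, zero_smul, zero_add]
  have hgeom : HasSum (fun n : ℕ => ‖x‖ ^ (n + 1)) (‖x‖ / (1 - ‖x‖)) := by
    simp_rw [pow_succ']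
    rw [div_eq_mul_inv]
    exact (hasSum_geometric_of_lt_one (norm_nonneg x) hx).mul_left ‖x‖
  exact tsum_of_norm_bounded hgeom fun n => norm_logSeriesCoeff_smul_pow_le x (n + 1)

/-- `‖log (1 + x)‖ ≤ 2‖x‖` for `‖x‖ ≤ 1/2`. [folklore] -/
theorem norm_logOnePlus_le_two_mul {x : 𝔄} (hx : ‖x‖ ≤ 1 / 2) : ‖logOnePlus x‖ ≤ 2 * ‖x‖ := by
  refine (norm_logOnePlus_le (hx.trans_lt (by norm_num))).trans ?_
  rw [div_le_iff₀ (by linarith)]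
  nlinarith [norm_nonneg x]

/-! ### Analyticity on the unit ball -/

omit [CompleteSpace 𝔄] in
/-- `logOnePlus` is the sum of the scalar power series with coefficients `logSeriesCoeff`.
[folklore] -/
theorem logOnePlus_eq_ofScalarsSum : (logOnePlus : 𝔄 → 𝔄) = ofScalarsSum logSeriesCoeff := by
  rw [ofScalarsSum_eq_tsum]; rfl

omit [CompleteSpace 𝔄] in
/-- The logarithmic power series has radius of convergence `≥ 1`. [folklore] -/
theorem one_le_radius_ofScalars_logSeriesCoeff : (1 : ENNReal) ≤ (ofScalars 𝔄 logSeriesCoeff).radius := by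
  refine ENNReal.le_of_forall_nnreal_lt fun r hr => ?_
  refine (ofScalars 𝔄 logSeriesCoeff).le_radius_of_bound 1 fun n => ?_
  have hr1 : (r : ℝ) ≤ 1 := by exact_mod_cast hr.le
  rcases Nat.eq_zero_or_pos n with rfl | hn
  · simp
  · calc ‖ofScalars 𝔄 logSeriesCoeff n‖ * (r : ℝ) ^ n ≤ 1 * 1 ^ n := by
          gcongr
          · exact (ofScalars_norm_le 𝔄 logSeriesCoeff n hn).trans (norm_logSeriesCoeff_le n)
      _ = 1 := by simp

/-- `logOnePlus` is given by its power series on the ball of convergence. [folklore] -/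
theorem hasFPowerSeriesOnBall_logOnePlus :
    HasFPowerSeriesOnBall (logOnePlus : 𝔄 → 𝔄) (ofScalars 𝔄 logSeriesCoeff) 0
      (ofScalars 𝔄 logSeriesCoeff).radius := by
  rw [logOnePlus_eq_ofScalarsSum]
  exact (ofScalars 𝔄 logSeriesCoeff).hasFPowerSeriesOnBall
    (lt_of_lt_of_le zero_lt_one one_le_radius_ofScalars_logSeriesCoeff)

/-- `x ↦ log (1 + x)` is analytic at every point of the open unit ball. [folklore] -/
theorem analyticAt_logOnePlus {x : 𝔄} (hx : ‖x‖ < 1) : AnalyticAt ℂ (logOnePlus : 𝔄 → 𝔄) x := by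
  refine hasFPowerSeriesOnBall_logOnePlus.analyticAt_of_mem ?_
  refine Metric.mem_eball.2 (lt_of_lt_of_le ?_ one_le_radius_ofScalars_logSeriesCoeff)
  rw [edist_zero_right, ← ofReal_norm]
  exact_mod_cast ENNReal.ofReal_lt_one.2 hx

/-- `x ↦ log (1 + x)` is holomorphic on the open unit ball. [folklore] -/
theorem differentiableOn_logOnePlus :
    DifferentiableOn ℂ (logOnePlus : 𝔄 → 𝔄) (ball 0 1) := fun _ hx =>
  (analyticAt_logOnePlus (mem_ball_zero_iff.1 hx)).differentiableAt.differentiableWithinAt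

/-- `x ↦ log (1 + x)` is continuous on the open unit ball. [folklore] -/
theorem continuousOn_logOnePlus : ContinuousOn (logOnePlus : 𝔄 → 𝔄) (ball 0 1) :=
  differentiableOn_logOnePlus.continuousOn

/-- Composition: if `u` is holomorphic on `s` with `‖u‖ < 1` there, so is `log (1 + u)`. [folklore] -/
theorem differentiableOn_logOnePlus_comp {E : Type*} [NormedAddCommGroup E] [NormedSpace ℂ E]
    {u : E → 𝔄} {s : Set E} (hu : DifferentiableOn ℂ u s) (h1 : ∀ z ∈ s, ‖u z‖ < 1) :
    DifferentiableOn ℂ (fun z => logOnePlus (u z)) s :=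
  (differentiableOn_logOnePlus (𝔄 := 𝔄)).comp hu fun z hz => mem_ball_zero_iff.2 (h1 z hz)

/-- Continuity of `log (1 + u)` for continuous `u` with `‖u‖ < 1`. [folklore] -/
theorem continuousOn_logOnePlus_comp {X : Type*} [TopologicalSpace X]
    {u : X → 𝔄} {s : Set X} (hu : ContinuousOn u s) (h1 : ∀ z ∈ s, ‖u z‖ < 1) :
    ContinuousOn (fun z => logOnePlus (u z)) s :=
  (continuousOn_logOnePlus (𝔄 := 𝔄)).comp hu fun z hz => mem_ball_zero_iff.2 (h1 z hz)

omit [CompleteSpace 𝔄] in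
/-- Every element lies in the (infinite) ball of convergence of the exponential series over `ℂ`
(bookkeeping for the `_of_mem_ball` lemmas of `NormedSpace.exp`). [folklore] -/
theorem mem_eball_expSeries_radius (x : 𝔄) :
    x ∈ Metric.eball (0 : 𝔄) (expSeries ℂ 𝔄).radius :=
  (expSeries_radius_eq_top ℂ 𝔄).symm ▸ edist_lt_top _ _

end General

/-! ### `exp ∘ log = id`: the commutative case -/

section Comm

variable {𝔠 : Type*} [NormedCommRing 𝔠] [NormedAlgebra ℂ 𝔠] [CompleteSpace 𝔠]

/-- In a commutative Banach algebra: for `ρ‖y‖ < 1` and `|t| < ρ`,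
`d/dt log (1 + t y) = y (1 + t y)⁻¹` (term-wise differentiation and the geometric series).
[folklore] -/
theorem hasDerivAt_logOnePlus_smul {y : 𝔠} {ρ : ℝ} (hρ : ρ * ‖y‖ < 1) {t : ℂ}
    (ht : t ∈ ball (0 : ℂ) ρ) :
    HasDerivAt (fun s : ℂ => logOnePlus (s • y)) (y * Ring.inverse (1 + t • y)) t := by
  have hρ0 : 0 < ρ := by
    have := mem_ball_zero_iff.1 ht
    linarith [norm_nonneg t]
  have hρy0 : 0 ≤ ρ * ‖y‖ := mul_nonneg hρ0.le (norm_nonneg y)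
  -- the shifted terms of the series and their derivatives
  set g : ℕ → ℂ → 𝔠 := fun n s => (logSeriesCoeff (n + 1) * s ^ (n + 1)) • y ^ (n + 1) with hg_def
  set g' : ℕ → ℂ → 𝔠 := fun n s => ((-1) ^ n * s ^ n) • y ^ (n + 1) with hg'_def
  have hg : ∀ n s, HasDerivAt (g n) (g' n s) s := by
    intro n s
    have h1 : HasDerivAt (fun s : ℂ => logSeriesCoeff (n + 1) * s ^ (n + 1))
        (logSeriesCoeff (n + 1) * (↑(n + 1) * s ^ n)) s :=
      (hasDerivAt_pow (n + 1) s).const_mul _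
    have h2 := h1.smul_const (y ^ (n + 1))
    simp only [Nat.cast_succ] at h2
    refine (h2.congr_deriv ?_ : HasDerivAt (g n) (g' n s) s)
    simp only [hg'_def]
    rw [← mul_assoc, logSeriesCoeff_succ_mul]
  have hg'le : ∀ n s, s ∈ ball (0 : ℂ) ρ → ‖g' n s‖ ≤ ‖y‖ * (ρ * ‖y‖) ^ n := by
    intro n s hs
    have hs' : ‖s‖ ≤ ρ := (mem_ball_zero_iff.1 hs).le
    calc ‖g' n s‖ ≤ ‖(-1 : ℂ) ^ n * s ^ n‖ * ‖y ^ (n + 1)‖ := norm_smul_le _ _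
      _ ≤ ρ ^ n * ‖y‖ ^ (n + 1) := by
          gcongr
          · rw [norm_mul, norm_pow, norm_neg, norm_one, one_pow, one_mul, norm_pow]
            exact pow_le_pow_left₀ (norm_nonneg _) hs' n
          · exact norm_pow_le' _ n.succ_pos
      _ = ‖y‖ * (ρ * ‖y‖) ^ n := by ring
  have hu : Summable fun n : ℕ => ‖y‖ * (ρ * ‖y‖) ^ n :=
    (summable_geometric_of_lt_one hρy0 hρ).mul_left _
  have h0 : (0 : ℂ) ∈ ball (0 : ℂ) ρ := mem_ball_self hρ0
  have hg0 : Summable fun n => g n 0 := by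
    simp only [hg_def, ne_eq, Nat.add_eq_zero_iff, one_ne_zero, and_false, not_false_eq_true,
      zero_pow, mul_zero, zero_smul]
    exact summable_zero
  have key := hasDerivAt_tsum_of_isPreconnected hu isOpen_ball (convex_ball (0 : ℂ) ρ).isPreconnected
    (fun n s _ => hg n s) (fun n s hs => hg'le n s hs) h0 hg0 ht
  -- the series is `log (1 + s y)` on the disc
  have hsmall : ∀ z ∈ ball (0 : ℂ) ρ, ‖z • y‖ < 1 := fun z hz =>
    (norm_smul_le z y).trans_lt
      ((mul_le_mul_of_nonneg_right (mem_ball_zero_iff.1 hz).le (norm_nonneg y)).trans_lt hρ)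
  have hfun : ∀ z ∈ ball (0 : ℂ) ρ, logOnePlus (z • y) = ∑' n, g n z := by
    intro z hz
    rw [logOnePlus, (summable_logOnePlus (hsmall z hz)).tsum_eq_zero_add]
    simp only [pow_zero, logSeriesCoeff_zero, zero_smul, zero_add, hg_def, smul_pow, smul_smul]
  -- and its derivative is `y (1 + t y)⁻¹`
  have hty : ‖-(t • y)‖ < 1 := by rw [norm_neg]; exact hsmall t ht
  have hval : ∑' n, g' n t = y * Ring.inverse (1 + t • y) := by
    have hterm : ∀ n, g' n t = y * (-(t • y)) ^ n := by
      intro n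
      simp only [hg'_def]
      rw [← neg_pow t n, ← neg_smul, smul_pow, pow_succ', mul_smul_comm]
    rw [tsum_congr hterm, (summable_geometric_of_norm_lt_one hty).tsum_mul_left,
      geom_series_eq_inverse _ hty, sub_neg_eq_add]
  refine (key.congr_of_eventuallyEq ?_).congr_deriv hval
  exact Filter.eventuallyEq_of_mem (isOpen_ball.mem_nhds ht) fun z hz => hfun z hz

omit [NormedAlgebra ℂ 𝔠] [CompleteSpace 𝔠] in
/-- For `‖y‖ < 1` there is `ρ > 1` with `ρ‖y‖ < 1`. [folklore] -/
theorem exists_one_lt_mul_norm_lt_one {y : 𝔠} (hy : ‖y‖ < 1) : ∃ ρ : ℝ, 1 < ρ ∧ ρ * ‖y‖ < 1 := by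
  by_cases h0 : ‖y‖ = 0
  · exact ⟨2, one_lt_two, by simp [h0]⟩
  · have hpos : 0 < ‖y‖ := (norm_nonneg y).lt_of_ne (Ne.symm h0)
    refine ⟨(1 + ‖y‖⁻¹) / 2, ?_, ?_⟩
    · have : 1 < ‖y‖⁻¹ := (one_lt_inv₀ hpos).2 hy
      linarith
    · rw [div_mul_eq_mul_div, add_mul, one_mul, inv_mul_cancel₀ h0]
      linarith

/-- **`exp (log (1 + y)) = 1 + y`** for `‖y‖ < 1`, commutative Banach algebra. [folklore] -/
theorem exp_logOnePlus_of_comm {y : 𝔠} (hy : ‖y‖ < 1) : exp (logOnePlus y) = 1 + y := by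
  obtain ⟨ρ, hρ1, hρy⟩ := exists_one_lt_mul_norm_lt_one hy
  have hρ0 : 0 < ρ := by linarith
  set G : ℂ → 𝔠 := fun s => logOnePlus (s • y) with hG
  set k : ℂ → 𝔠 := fun s => exp (-G s) * (1 + s • y) with hk
  have hsmall : ∀ z ∈ ball (0 : ℂ) ρ, ‖z • y‖ < 1 := fun z hz =>
    (norm_smul_le z y).trans_lt
      ((mul_le_mul_of_nonneg_right (mem_ball_zero_iff.1 hz).le (norm_nonneg y)).trans_lt hρy)
  have hderiv : ∀ t ∈ ball (0 : ℂ) ρ, HasDerivAt k 0 t := by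
    intro t ht
    have hGd : HasDerivAt G (y * Ring.inverse (1 + t • y)) t := hasDerivAt_logOnePlus_smul hρy ht
    have hunit : IsUnit (1 + t • y) := by
      have h := (Units.oneSub (-(t • y)) (by rw [norm_neg]; exact hsmall t ht)).isUnit
      rwa [Units.val_oneSub, sub_neg_eq_add] at h
    have hexp : HasFDerivAt (exp : 𝔠 → 𝔠) (exp (-G t) • (1 : 𝔠 →L[ℂ] 𝔠)) (-G t) :=
      hasFDerivAt_exp
    have h1 : HasDerivAt (fun s => exp (-G s))
        (exp (-G t) * -(y * Ring.inverse (1 + t • y))) t := by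
      have h := hexp.comp_hasDerivAt t hGd.neg
      have hfeq : (exp ∘ (-G)) = fun s => exp (-G s) := rfl
      rw [hfeq] at h
      refine h.congr_deriv ?_
      rw [_root_.smul_apply, one_apply_eq_self, smul_eq_mul]
    have h2 : HasDerivAt (fun s : ℂ => 1 + s • y) y t := by
      have h := ((hasDerivAt_id t).smul_const y).const_add (1 : 𝔠)
      rwa [one_smul] at h
    have h3 := h1.mul h2
    have hfeq2 : ((fun s => exp (-G s)) * fun s : ℂ => 1 + s • y) = k := rfl
    rw [hfeq2] at h3
    have hRinv : Ring.inverse (1 + t • y) * (1 + t • y) = 1 := Ring.inverse_mul_cancel _ hunit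
    refine h3.congr_deriv ?_
    rw [mul_assoc (exp (-G t)), neg_mul, mul_assoc y, hRinv, mul_one, mul_neg, neg_add_cancel]
  have hdiff : DifferentiableOn ℂ k (ball 0 ρ) := fun t ht =>
    (hderiv t ht).differentiableAt.differentiableWithinAt
  have h1mem : (1 : ℂ) ∈ ball (0 : ℂ) ρ := by simpa using hρ1
  have hconst : k 0 = k 1 :=
    isOpen_ball.is_const_of_deriv_eq_zero (convex_ball (0 : ℂ) ρ).isPreconnected hdiff
      (fun t ht => (hderiv t ht).deriv) (mem_ball_self hρ0) h1mem
  have hk0 : k 0 = 1 := by simp [hk, hG]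
  have hk1 : k 1 = exp (-logOnePlus y) * (1 + y) := by simp [hk, hG]
  have hprod : exp (logOnePlus y) * exp (-logOnePlus y) = 1 := by
    rw [← exp_add_of_mem_ball (mem_eball_expSeries_radius _) (mem_eball_expSeries_radius _),
      add_neg_cancel, exp_zero]
  calc exp (logOnePlus y) = exp (logOnePlus y) * (exp (-logOnePlus y) * (1 + y)) := by
        rw [← hk1, ← hconst, hk0, mul_one]
    _ = 1 + y := by rw [← mul_assoc, hprod, one_mul]

end Comm

/-! ### `exp ∘ log = id`: the general case -/

section General

variable {𝔄 : Type*} [NormedRing 𝔄] [NormedAlgebra ℂ 𝔄] [CompleteSpace 𝔄]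

/-- **`exp (log (1 + x)) = 1 + x`** for `‖x‖ < 1` in any complete normed `ℂ`-algebra: apply the
commutative case in the closed subalgebra generated by `x` and push forward along the inclusion.
[folklore] -/
theorem exp_logOnePlus {x : 𝔄} (hx : ‖x‖ < 1) : exp (logOnePlus x) = 1 + x := by
  let 𝔠 : Subalgebra ℂ 𝔄 := Algebra.elemental ℂ x
  letI : NormedCommRing 𝔠 := { (inferInstance : NormedRing 𝔠) with mul_comm := mul_comm }
  let y : 𝔠 := ⟨x, Algebra.elemental.self_mem ℂ x⟩
  have hy : ‖y‖ < 1 := hx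
  have h := exp_logOnePlus_of_comm hy
  have hval : ∀ z : 𝔠, ((exp z : 𝔠) : 𝔄) = exp (z : 𝔄) := fun z =>
    map_exp_of_mem_ball (𝕂 := ℂ) 𝔠.val continuous_subtype_val z (mem_eball_expSeries_radius z)
  have hlog : ((logOnePlus y : 𝔠) : 𝔄) = logOnePlus x := by
    have hs := (hasSum_logOnePlus hy).map 𝔠.val continuous_subtype_val
    have hs' : HasSum (fun n : ℕ => logSeriesCoeff n • x ^ n) ((logOnePlus y : 𝔠) : 𝔄) := by
      simpa [Function.comp_def] using hs
    exact hs'.tsum_eq.symm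
  have h' := congrArg ((↑) : 𝔠 → 𝔄) h
  rw [hval, hlog] at h'
  simpa [y] using h'

/-- Variant: every `u` with `‖u - 1‖ < 1` is an exponential, `u = exp (log (1 + (u - 1)))`.
[folklore] -/
theorem exp_logOnePlus_sub_one {u : 𝔄} (hu : ‖u - 1‖ < 1) : exp (logOnePlus (u - 1)) = u := by
  rw [exp_logOnePlus hu, add_sub_cancel]

/-- In particular such `u` is a unit (also clear from the Neumann series). [folklore] -/
theorem isUnit_of_norm_sub_one_lt_one' {u : 𝔄} (hu : ‖u - 1‖ < 1) : IsUnit u :=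
  exp_logOnePlus_sub_one hu ▸ isUnit_exp_of_mem_ball (mem_eball_expSeries_radius _)

end General

end Literature.Analysis.Complex
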